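import Summits.BirchSwinnertonDyer.BirchSwinnertonDyer.Theses.AdditiveKolyvaginRoad
import HarnessLib

/-!
# Crux r2 `KolyvaginPrimitiveAdditive` (KPA′, stmt-BirchSwinnertonDyer-21400) — line `birth`, skeleton v11.2
# (lead prover bsd-wall-akr-p1 g8, 2026-08-28): W. ZHANG'S RANK SPLIT, INPUT-FREE, NO STUB ≡ KS′, NO STUB ≡ THE CRUX

WHY v11. v10 (7e88b0632f34f05f, 2026-08-27) had four stubs P ∕ J2 ∕ KS ∕ LOC with KPA′ ⟸ P ∧ J2 ∧ KS ∧ LOC. Since then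
(numbers): J2 LANDED p638401 and LOC LANDED p638533 (akr-p2x-w3 g10, on the Poitou–Tate THEOREM p624636); KS is the crux
KS′ stmt-BirchSwinnertonDyer-21396 VERBATIM, and KS′ ⟸ KPA′ INPUT-FREE is a tree theorem
(`AdditiveKoly.levelKolyvaginSystemsAdditive_of_kolyvaginPrimitiveAdditive_free`, p635192), while 21396's own registry
(v15, 6207d784f09a0818) is ONE stub ≡ KPA′. So the two registries were a fixed point, not a decomposition, and after the
route's W-84 (α) (rev 23: `closes` binds `(h₁ : KolyvaginPrimitiveAdditive)` directly; KS′ = corollary) the deciding crux is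
THIS item. v11 removes KS and splits KPA′ ITSELF along W. Zhang's induction variable, the 𝔽_p-dimension `s` of `Sel_p(E/K)`:

* **P** `stub_oddSelmerRankAdditive` (v3 text, token-identical to v10's registered stub): `#Sel_p(E/K) = p^s` with `s` odd.
  PUBLISHED-ONLY content (Gross–Zagier + Kolyvagin: rank 1, Ш finite; levelwise Cassels–Tate: `dim Ш[p]` even; `ρ̄` onto:
  `E(K)[p] = 0`). Closed MODULO named facts: `AdditiveKoly.oddSelmerRankAdditive_of_levelInputs` (p557719) ⟸ PUB ∧ DUAL.1, and
  DUAL.1 ⟸ hPTc (`CasselsTateConj.casselsTate_levelInputs_of_shaTwoCochain`). Not landable bare; nobody's target.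
* **R1** `stub_selmerRankOnePinnedAdditive` — KOLYVAGIN AT THE BOTTOM RANK, WITNESS PINNED AT `n = 1`: at a ♯ frame with
  `#Sel_p(E/K) = p`, SOME conductor-1 Kolyvagin–Heegner datum has `c₁(1) ≠ 0` in `H¹(K, E[p])` (⟺ `y_K ∉ p·E(K)`,
  `AdditiveKoly.kolyvaginClass_one_ne_zero_iff_heegnerPoint_not_pDiv`). NOT a restriction of the crux (the witness level is
  named): W. Zhang 2014 Thm. 1.2 ∕ Thm. 7.2 at good ordinary `p`, Skinner–Zhang at `p ∥ N` — the rank-one `p`-indivisibility of the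
  Heegner point, i.e. the `p`-part of BSD in rank one on the `Ш[p] = 0` locus (= the promoted-then-asided BOT′ 21397 in
  `Sel_p`-cardinality dress). OPEN at `p² ∣ N`: the rank-0 anchor for the one-prime level-raised form of E's additive type +
  the first reciprocity law at `p²`-level — DEAD-LINES D1–D3, MEMO-anchor-v1 of Cruxes/LevelKolyvaginSystemsAdditive.
* **R3** `stub_higherSelmerRankAboveBottomAdditive` — KOLYVAGIN ABOVE THE BOTTOM: at a ♯ frame with `#Sel_p(E/K) = p^s`, `s` odd
  `≥ 3`, every conductor-1 datum having `c₁(1) = 0`, some datum of Kolyvagin-prime support has `c₁(n) ≠ 0` (W. Zhang Thm. 9.1: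
  level raising at two admissible primes + rank lowering (A1, LANDED p521749) + the engine (LANDED p534939) + transport
  Thm. 4.3 + the same anchor at the two-prime levels; print: `p ∤ N` only).

R3 is STRICTLY WEAKER than KPA′ (a restriction: extra hypotheses); R1 is pinned (stronger than the corresponding restriction,
weaker than BOT′ + CM rationality in nature, and not a λ-term of the crux — the `p = 3` precedent 19574 v2y «S1 PINNED»); neither
is ≡ KS′; with P they give KPA′ by the case split below. The BOTTOM (some conductor-1 datum with `c₁(1) ≠ 0`) needs no stub: that datum is the witness at `n = 1`
(`KolyvaginDescent.kolSupp_one`), proved inline (`conclusion_of_bottom`; = akr-p2x-w2 g7's `kolyvaginPrimitiveAdditive_conclusion_of_bottom`,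
p634919, restated here to keep the skeleton's imports to the route file).

STUBS (3, ≤ stubs_max): P (published-only) ∕ R1 (research, pinned) ∕ R3 (research, restriction). LANDED history of the line (credited under `supports`
of 21400): A1 p521749, ENGINE p534939, J2 p638401, LOC p638533; helpers p561938 p562934 p571881 p572904 p575551 p576885 p577723
p619900 p620657. HONEST FRAMING: a skeleton; 3 `sorry`s, each inside a registered `stub_*`; closes nothing. 21400 is INPUT-FREE.
A conductor-1 datum EXISTS with no input (`AdditiveKoly.nonempty_kolyvaginHeegnerData_one`: Darmon 2004 Thm. 3.6 is the tree theorem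
`phi_heegnerTau_mem_singularModuliField_holds`); what a bare landing consumes from print, besides the research anchor, is Gross–Zagier
(`gross_zagier`: `y_K` of infinite order), Kolyvagin (`kolyvagin`, `Kolyvagin1990_padicValNat_card_sha_le`) and McCallum's structure
halves (`McCallum1991_…`) — PUB conjuncts with no `_holds` in the tree (2026-08-28). BSD is not proved by any of this; Kolyvagin's
conjecture mod `p` at an additive prime is OPEN in print at `p² ∣ N`. (v11.2 = v11.1 with this paragraph and R1's docstring corrected;
stub texts byte-identical.)
History v1 → v10: evidence trail of stmt-BirchSwinnertonDyer-20132 ∕ -21400 (Lines_birth_v*.lean). -/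

set_option linter.dupNamespace false

noncomputable section

open scoped Classical

namespace Summit.BirchSwinnertonDyer.BirchSwinnertonDyer.Cruxes.KolyvaginPrimitiveAdditive.Birth

open WeierstrassCurve NumberField IsDedekindDomain Literature.NumberTheory.EllipticCurves
  Literature.NumberTheory.EllipticCurves.ModularForms
  Literature.NumberTheory.EllipticCurves.Rank1Residual
  Literature.NumberTheory.GaloisRepresentations
  Summit.BirchSwinnertonDyer.Rank1Residual
  Summit.BirchSwinnertonDyer.BirchSwinnertonDyer.Theorems.AdditiveKoly

/-! ## §1 The three stubs -/

/-- STUB P (v3, VERBATIM; token-identical to v10's registered stub) — THE p-PARITY OF `Sel_p(E/K)` AT A ♯ ADDITIVE FRAME: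
`#Sel_p(E/K) = p^s` with `s` ODD. Not part of Kolyvagin's conjecture: `rank E(K) = 1` and `Ш(E/K)` finite [Gross–Zagier +
Kolyvagin on the frame: `r_an(E/K) = r_an(E) + r_an(E^{d_K}) = 1 + 0`], `dim_𝔽_p Ш(E/K)[p]` even [levelwise Cassels–Tate],
`E(K)[p] = 0` [`ρ̄` onto]; = Zhang Thm 9.2 ∕ the `p`-parity theorem. CLOSED MODULO NAMED FACTS:
`Theorems.AdditiveKoly.oddSelmerRankAdditive_of_levelInputs` (p557719) ⟸ PUB ∧ DUAL.1. Published-only; not landable bare.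
[cite: WZhang2014, Thm. 9.2] -/
theorem stub_oddSelmerRankAdditive :
  ∀ (W : WeierstrassCurve ℚ) [W.IsElliptic] [W.IsGloballyMinimal] [NeZero (W.conductorNorm ℤ)]
    (p : ℕ) [Fact p.Prime] (K : Type) [Field K] [NumberField K]
    (Dt : ModularParametrizationData W (W.conductorNorm ℤ)) (β : ℤ) (ι : K →+* ℂ),
    5 ≤ p → Addv W p → W.HasSurjectiveModNGaloisRep p →
    (∀ (ℓ : ℕ) [Fact ℓ.Prime], W.HasMultiplicativeReductionAtPrime ℓ →
      ¬ p ∣ padicValInt ℓ W.minimalDiscriminantInt) →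
    (∃ (ℓ₁ ℓ₂ : ℕ) (_ : Fact ℓ₁.Prime) (_ : Fact ℓ₂.Prime), ℓ₁ ≠ ℓ₂ ∧
      W.HasMultiplicativeReductionAtPrime ℓ₁ ∧ W.HasMultiplicativeReductionAtPrime ℓ₂) →
    ¬ p ∣ W.tamagawaProduct → W.analyticRank = 1 →
    IsImaginaryQuadratic K → Odd (NumberField.discr K) →
    SatisfiesHeegnerHypothesis (W.conductorNorm ℤ) K →
    (W.quadraticTwist (NumberField.discr K : ℚ)).entireLFunction 1 ≠ 0 →
    (4 * (W.conductorNorm ℤ : ℤ)) ∣ β ^ 2 - NumberField.discr K → ¬ (p : ℤ) ∣ Dt.c →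
    ∃ s : ℕ, Odd s ∧ Nat.card (WeierstrassCurve.selmerGroup (W.baseChange K) (p : ℤ)) = p ^ s
    := by
  sorry

/-- STUB R1 (v11) — KOLYVAGIN'S CONJECTURE MOD `p` AT THE BOTTOM RANK, WITNESS PINNED AT LEVEL `n = 1`: at a ♯ additive
frame (`p ≥ 5`, `Addv`, `ρ̄` onto, ♠(1)(2), `p ∤ ∏ c_ℓ`, `r_an = 1`, `K` imaginary quadratic, `d_K` odd `< −4`, Heegner
hypothesis, `L(E^{d_K},1) ≠ 0`, `4N ∣ β² − d_K`, `p ∤ c_Manin`) with `#Sel_p(E/K) = p`, SOME conductor-1 Kolyvagin–Heegner datum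
has `c₁(1) ≠ 0` in `H¹(K, E[p])` — equivalently (tree, no named fact: `AdditiveKoly.kolyvaginClass_one_ne_zero_iff_heegnerPoint_not_pDiv`)
the Heegner point `y_K` is not `p`-divisible in `E(K)`. The `s = 1` case of W. Zhang's induction with the witness level NAMED
(his Thm. 1.2 ∕ Thm. 7.2; the rank-one `p`-indivisibility of the Heegner point = the `p`-part of BSD in rank one on the
`Ш(E/K)[p] = 0` locus); research: the rank-0 anchor for the level-raised form of E's additive type at ONE admissible prime + the
first reciprocity law at `p²`-level are unprinted (print: `p ∤ N` Zhang 2014; `p ∥ N` Skinner–Zhang 2014). A conductor-1 datum exists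
with no input (`AdditiveKoly.nonempty_kolyvaginHeegnerData_one`, Darmon Thm. 3.6 proved); the print inputs consumed besides the anchor
are Gross–Zagier (`y_K` of infinite order), Kolyvagin and McCallum — PUB conjuncts, not tree theorems. presearch: none
at `p² ∣ N` (DEAD-LINES.md D1–D3, MEMO-anchor-v1.md, ABOVE-THE-BOTTOM.md §4 of Cruxes/LevelKolyvaginSystemsAdditive; corpus +
galaxy). [cite: WZhang2014, Thm. 1.2, Thm. 7.2] [cite: SkinnerZhang2014, Thm. 1.1] [cite: GrossLMS1991, §4] -/
theorem stub_selmerRankOnePinnedAdditive :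
  ∀ (W : WeierstrassCurve ℚ) [W.IsElliptic] [W.IsGloballyMinimal] [NeZero (W.conductorNorm ℤ)]
    (p : ℕ) [Fact p.Prime] (K : Type) [Field K] [NumberField K]
    (Dt : ModularParametrizationData W (W.conductorNorm ℤ)) (β : ℤ) (ι : K →+* ℂ),
    5 ≤ p → Addv W p → W.HasSurjectiveModNGaloisRep p →
    (∀ (ℓ : ℕ) [Fact ℓ.Prime], W.HasMultiplicativeReductionAtPrime ℓ →
      ¬ p ∣ padicValInt ℓ W.minimalDiscriminantInt) →
    (∃ (ℓ₁ ℓ₂ : ℕ) (_ : Fact ℓ₁.Prime) (_ : Fact ℓ₂.Prime), ℓ₁ ≠ ℓ₂ ∧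
      W.HasMultiplicativeReductionAtPrime ℓ₁ ∧ W.HasMultiplicativeReductionAtPrime ℓ₂) →
    ¬ p ∣ W.tamagawaProduct → W.analyticRank = 1 →
    IsImaginaryQuadratic K → Odd (NumberField.discr K) → NumberField.discr K < -4 →
    SatisfiesHeegnerHypothesis (W.conductorNorm ℤ) K →
    (W.quadraticTwist (NumberField.discr K : ℚ)).entireLFunction 1 ≠ 0 →
    (4 * (W.conductorNorm ℤ : ℤ)) ∣ β ^ 2 - NumberField.discr K → ¬ (p : ℤ) ∣ Dt.c →
    Nat.card (WeierstrassCurve.selmerGroup (W.baseChange K) (p : ℤ)) = p →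
    ∃ d₁ : KolyvaginHeegnerData Dt β ι 1, d₁.kolyvaginClass (Fact.out : p.Prime) 1 ≠ 0
    := by
  sorry

/-- STUB R3 (v11) — KOLYVAGIN'S CONJECTURE MOD `p` ABOVE THE BOTTOM RANK: at a ♯ additive frame (binders as in R1) with
`#Sel_p(E/K) = p^s`, `s` ODD and `≥ 3`, at which every conductor-1 Kolyvagin–Heegner datum has `c₁(1) = 0`, SOME
Kolyvagin–Heegner datum of Kolyvagin-prime support has `c₁(n) ≠ 0`. The `s ≥ 3` case of W. Zhang's Thm. 9.1 (level raising at
two Bertolini–Darmon admissible primes, rank lowering = the LANDED A1 p521749, the LANDED engine p534939, transport = Zhang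
Thm. 4.3, and the rank-0 anchor for the two-prime level-raised forms of E's additive type); strictly weaker than the crux;
research (print: `p ∤ N` only). Kernel reading: R3 at a frame ⟸ a `LevelKolyvaginSystemP` at the frame (engine + LOC p638533 +
A1), and such a system ⟸ KPA′'s conclusion at the frame (p635192's synthetic door) — no finer split exists in tree currency
without typing the level-raised forms. presearch: as R1. [cite: WZhang2014, Thm. 9.1, Thm. 4.3, §9] -/
theorem stub_higherSelmerRankAboveBottomAdditive :
  ∀ (W : WeierstrassCurve ℚ) [W.IsElliptic] [W.IsGloballyMinimal] [NeZero (W.conductorNorm ℤ)]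
    (p : ℕ) [Fact p.Prime] (K : Type) [Field K] [NumberField K]
    (Dt : ModularParametrizationData W (W.conductorNorm ℤ)) (β : ℤ) (ι : K →+* ℂ),
    5 ≤ p → Addv W p → W.HasSurjectiveModNGaloisRep p →
    (∀ (ℓ : ℕ) [Fact ℓ.Prime], W.HasMultiplicativeReductionAtPrime ℓ →
      ¬ p ∣ padicValInt ℓ W.minimalDiscriminantInt) →
    (∃ (ℓ₁ ℓ₂ : ℕ) (_ : Fact ℓ₁.Prime) (_ : Fact ℓ₂.Prime), ℓ₁ ≠ ℓ₂ ∧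
      W.HasMultiplicativeReductionAtPrime ℓ₁ ∧ W.HasMultiplicativeReductionAtPrime ℓ₂) →
    ¬ p ∣ W.tamagawaProduct → W.analyticRank = 1 →
    IsImaginaryQuadratic K → Odd (NumberField.discr K) → NumberField.discr K < -4 →
    SatisfiesHeegnerHypothesis (W.conductorNorm ℤ) K →
    (W.quadraticTwist (NumberField.discr K : ℚ)).entireLFunction 1 ≠ 0 →
    (4 * (W.conductorNorm ℤ : ℤ)) ∣ β ^ 2 - NumberField.discr K → ¬ (p : ℤ) ∣ Dt.c →
    ∀ s : ℕ, Odd s → 3 ≤ s →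
    Nat.card (WeierstrassCurve.selmerGroup (W.baseChange K) (p : ℤ)) = p ^ s →
    (∀ d₁ : KolyvaginHeegnerData Dt β ι 1, d₁.kolyvaginClass (Fact.out : p.Prime) 1 = 0) →
    ∃ (n : ℕ) (d : KolyvaginHeegnerData Dt β ι n),
      KolyvaginDescent.KolSupp (Zhang2014.IsKolyvaginPrime (W.conductorNorm ℤ) W K p) n ∧
        d.kolyvaginClass (Fact.out : p.Prime) 1 ≠ 0
    := by
  sorry

/-! ## §2 The bottom (no stub) and the composition -/

/-- THE BOTTOM NEEDS NO STUB (pure logic, no named fact): a conductor-1 Kolyvagin–Heegner datum with `c₁(1) ≠ 0` is itself the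
witness, `n = 1` having Kolyvagin-prime support vacuously (`KolyvaginDescent.kolSupp_one`). Same statement as akr-p2x-w2 g7's
`AdditiveKoly.kolyvaginPrimitiveAdditive_conclusion_of_bottom` (p634919), restated to keep this skeleton's imports to the route
file. [cite: GrossLMS1991, §4 (P_1 = y_K)] -/
theorem conclusion_of_bottom {W : WeierstrassCurve ℚ} [W.IsElliptic] [W.IsGloballyMinimal] [NeZero (W.conductorNorm ℤ)]
    {p : ℕ} [hp : Fact p.Prime] {K : Type} [Field K] [NumberField K]
    {Dt : ModularParametrizationData W (W.conductorNorm ℤ)} {β : ℤ} {ι : K →+* ℂ}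
    (h : ∃ d₁ : KolyvaginHeegnerData Dt β ι 1, d₁.kolyvaginClass hp.out 1 ≠ 0) :
    ∃ (n : ℕ) (d : KolyvaginHeegnerData Dt β ι n),
      KolyvaginDescent.KolSupp (Zhang2014.IsKolyvaginPrime (W.conductorNorm ℤ) W K p) n ∧
        d.kolyvaginClass (Fact.out : p.Prime) 1 ≠ 0 := by
  obtain ⟨d₁, hd₁⟩ := h
  exact ⟨1, d₁, KolyvaginDescent.kolSupp_one _, hd₁⟩

/-- An odd natural number is `1` or at least `3`. [folklore] -/
theorem eq_one_or_three_le_of_odd {s : ℕ} (hs : Odd s) : s = 1 ∨ 3 ≤ s := by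
  obtain ⟨k, rfl⟩ := hs
  rcases k with _ | k
  · exact Or.inl rfl
  · exact Or.inr (by omega)

/-- COMPOSITION (v11, sorry-free, NO named fact): the route crux BY NAME from the three stubs — at a frame, either some
conductor-1 datum has `c₁(1) ≠ 0` (the bottom: `conclusion_of_bottom`), or every conductor-1 datum has `c₁(1) = 0` and the
PARITY CASE SPLIT on `#Sel_p(E/K) = p^s` (stub P, `s` odd): at `s = 1` stub R1 PRODUCES a conductor-1 datum with `c₁(1) ≠ 0`
(so this branch is in fact contradictory), at `s ≥ 3` stub R3 gives the conclusion. -/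
theorem KolyvaginPrimitiveAdditive_of :
    Summit.BirchSwinnertonDyer.BirchSwinnertonDyer.Theses.AdditiveKolyvaginRoad.KolyvaginPrimitiveAdditive := by
  intro W _ _ _ p _ K _ _ Dt β ι h5 hadd hsurj hsp1 hsp2 htam hr1 hK hodd hd hHH hL hβ hc
  by_cases hbot : ∃ d₁ : KolyvaginHeegnerData Dt β ι 1, d₁.kolyvaginClass (Fact.out : p.Prime) 1 ≠ 0
  · exact conclusion_of_bottom hbot
  · push Not at hbot
    obtain ⟨s, hsodd, hs⟩ :=
      stub_oddSelmerRankAdditive W p K Dt β ι h5 hadd hsurj hsp1 hsp2 htam hr1 hK hodd hHH hL hβ hc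
    rcases eq_one_or_three_le_of_odd hsodd with h1 | h3
    · subst h1
      rw [pow_one] at hs
      exact conclusion_of_bottom
        (stub_selmerRankOnePinnedAdditive W p K Dt β ι h5 hadd hsurj hsp1 hsp2 htam hr1 hK hodd hd hHH hL hβ hc hs)
    · exact stub_higherSelmerRankAboveBottomAdditive W p K Dt β ι h5 hadd hsurj hsp1 hsp2 htam hr1 hK hodd hd hHH hL
        hβ hc s hsodd h3 hs hbot

/-! ## §3 Bookkeeping (no sorry): R3 is a RESTRICTION of the crux (R1 is not: its witness level is pinned) -/

/-- R3 is implied by the crux by name (extra hypotheses dropped): a landing of 21400 closes R3 mechanically. -/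
theorem stub_higherSelmerRankAboveBottomAdditive_of_kolyvaginPrimitiveAdditive
    (hKPA : Summit.BirchSwinnertonDyer.BirchSwinnertonDyer.Theses.AdditiveKolyvaginRoad.KolyvaginPrimitiveAdditive) :
  ∀ (W : WeierstrassCurve ℚ) [W.IsElliptic] [W.IsGloballyMinimal] [NeZero (W.conductorNorm ℤ)]
    (p : ℕ) [Fact p.Prime] (K : Type) [Field K] [NumberField K]
    (Dt : ModularParametrizationData W (W.conductorNorm ℤ)) (β : ℤ) (ι : K →+* ℂ),
    5 ≤ p → Addv W p → W.HasSurjectiveModNGaloisRep p →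
    (∀ (ℓ : ℕ) [Fact ℓ.Prime], W.HasMultiplicativeReductionAtPrime ℓ →
      ¬ p ∣ padicValInt ℓ W.minimalDiscriminantInt) →
    (∃ (ℓ₁ ℓ₂ : ℕ) (_ : Fact ℓ₁.Prime) (_ : Fact ℓ₂.Prime), ℓ₁ ≠ ℓ₂ ∧
      W.HasMultiplicativeReductionAtPrime ℓ₁ ∧ W.HasMultiplicativeReductionAtPrime ℓ₂) →
    ¬ p ∣ W.tamagawaProduct → W.analyticRank = 1 →
    IsImaginaryQuadratic K → Odd (NumberField.discr K) → NumberField.discr K < -4 →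
    SatisfiesHeegnerHypothesis (W.conductorNorm ℤ) K →
    (W.quadraticTwist (NumberField.discr K : ℚ)).entireLFunction 1 ≠ 0 →
    (4 * (W.conductorNorm ℤ : ℤ)) ∣ β ^ 2 - NumberField.discr K → ¬ (p : ℤ) ∣ Dt.c →
    ∀ s : ℕ, Odd s → 3 ≤ s →
    Nat.card (WeierstrassCurve.selmerGroup (W.baseChange K) (p : ℤ)) = p ^ s →
    (∀ d₁ : KolyvaginHeegnerData Dt β ι 1, d₁.kolyvaginClass (Fact.out : p.Prime) 1 = 0) →
    ∃ (n : ℕ) (d : KolyvaginHeegnerData Dt β ι n),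
      KolyvaginDescent.KolSupp (Zhang2014.IsKolyvaginPrime (W.conductorNorm ℤ) W K p) n ∧
        d.kolyvaginClass (Fact.out : p.Prime) 1 ≠ 0 := by
  intro W _ _ _ p _ K _ _ Dt β ι h5 hadd hsurj hsp1 hsp2 htam hr1 hK hodd hd hHH hL hβ hc _ _ _ _ _
  exact hKPA W p K Dt β ι h5 hadd hsurj hsp1 hsp2 htam hr1 hK hodd hd hHH hL hβ hc

end Summit.BirchSwinnertonDyer.BirchSwinnertonDyer.Cruxes.KolyvaginPrimitiveAdditive.Birth

end
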